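import Literature.MathematicalPhysics.QuantumFieldTheory.Balaban1983to89.B9Eq3126H1BoundUniform
import Literature.MathematicalPhysics.QuantumFieldTheory.Balaban1983to89.B9Eq386ResolventLetters
import Literature.MathematicalPhysics.QuantumFieldTheory.Balaban1983to89.B9Eq384LaplaceALipschitzUniform

/-!
# `Balaban1983to89.B9Eq386LipschitzH1Uniform` — T. Bałaban, *Propagators for lattice gauge theories in a background field*, Commun. Math. Phys.
# **99** (1985) 389–434 [Balaban1985BackgroundPropagators] Thm 3.4 p. 400 / (3.86) p. 407 with (3.126) p. 420 and Thm 3.11 p. 416: THE pub-balaban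
# NE9 CHAIN'S `G₁(U) = Δ_a(U)⁻¹` AND `H₁(U) = G₁Q†(QG₁Q†)⁻¹` ARE LIPSCHITZ IN THE BACKGROUND AT THE FLAT POINT WITH `C₁, C₂, ε₇` INDEPENDENT OF THE
# VOLUME — `∃ C₁ C₂ ε₇ > 0` BEFORE `∀ m`: `‖G₁(U) − G₁(1)‖ ≤ C₁·ε`, `‖H₁(U) − H₁(1)‖ ≤ C₂·ε` for `‖U(b) − 1‖ ≤ ε ≤ ε₇` on EVERY lattice `TSite d (L·m)`

statement-level skeleton of published theorems with citation tags; proofs where landed; nothing here is a claim about the Yang–Mills mass gap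

PDF held: `paper:balaban1985-cmp99-background-propagators` (journal page = PDF page + 388), pp. 400, 407, 416, 420 read by this seat (2026-08-22; text
layer p0012, p0019, p0028, p0032).

THE PRINT (verbatim).  p. 400, Thm 3.4: *«small perturbations of the operators depending on U only»*; p. 407: *«G(U′U) = G(U)(I − V(A)G(U))⁻¹ (3.86)»*;
p. 420, (3.126): *«HB = GQ*(QGQ*)⁻¹B»*; p. 416, Thm 3.11: *«for M sufficiently large and α₀ sufficiently small»* — a smallness that does not see the
volume.

WHY THIS FILE (cell context).  The NE9 owner's `B9Eq386LipschitzH1.exists_lipschitz_G1_H1_at_flat` (t4-ne9-p1 gen 81, INTENT-2 (Q2)) is stated at a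
FIXED lattice: `C₁, C₂, ε₇` see the volume `m` through (i) the per-lattice coercivity/remainder letters it consumes
(`B9Thm311SmallFieldGreen.exists_coercive_laplaceA_of_small_field`, `B9Eq384LaplaceALipschitz.exists_laplaceAofBackground_sub_flat_le`), (ii) the
abstract operator norm `‖Q(1)‖`, (iii) the COMPACTNESS modulus of `Q(1)†` (`B9Eq3126GreenLetters.exists_modulus_of_injective`), (iv)
`CQ = M_φ′M_φ√(c₁·#Bond/c₀)·102(d+1)²L`.  Every one has a volume-free replacement in the tree as of 2026-08-22T07:xxZ: (i) NE9 leaf-03's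
`B9Thm311SmallFieldClosedUniform.exists_coercive_laplaceA_of_small_field_uniform` and `B9Eq384LaplaceALipschitzUniform.exists_laplaceAofBackground_
sub_flat_le_uniform`, (ii) `B9Eq315QFlatNorm.norm_QtorusW_one_le`, (iii) this lineage's EXPLICIT `B9Eq315QFlatRightInverse.modulus_adjoint_QtorusW_one`
(`μ_Q1 = (√(c₀L^{d+2}/c₁))⁻¹` — the owner's W-6 «AGREED in substance»), (iv) this lineage's `B9Eq383QSemiLocal.norm_QtorusW_sub_flat_le_local`.  This
file is the owner's proof with the four re-plugs and `m` quantified INSIDE — item (Q2′) of the volume-free Lipschitz batch ((Q1′) leaf-03, (Q3a′)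
`B9Eq368RLipschitzUniform`, (Q3′) next).

WHAT IS PROVED (sorry-free; 0 `def`; no inequality of the paper asserted).
* **`exists_lipschitz_G1_H1_at_flat_uniform`** — `∃ C₁ C₂ ε₇ > 0` (numbers of `d, L, η, a, c₀, c₁, M_φ, M_φ′, C_τ`) such that on EVERY lattice, for every
  `U` of E162's data with `‖U(b) − 1‖ ≤ ε ≤ ε₇` and `hRS`, for ANY positivity / surjectivity witnesses `hpos hQ` (at `U`), `hpos₁ hQ₁` (at `1`):
  `‖G₁(U)z − G₁(1)z‖ ≤ C₁·ε·‖z‖` and `‖H₁(U)b − H₁(1)b‖ ≤ C₂·ε·‖b‖` — the owner's conclusion VERBATIM, resolvent algebra by `B9Eq386ResolventLetters`.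
MODEL / DECLARED READINGS.  (M1) one averaging step on `TSite d (L·m)`, weights `c₀, c₁`, Hilbert fibre `W` read in `𝔸`; the flat point only; `L²`
operator norms.  (M2) no hypothesis of the papers displayed.  (M3) NOT HERE: uniformity in the SPACING `η` or in `L`, analyticity in `A`, two general
small fields, the chart's Banach norms ((N)/(K)), `𝔊(U)` ((Q3′)).
HONEST SCOPE.  Restatement class; the proof text is the OWNER t4-ne9-p1 gen 81's, re-plugged (attributed); «NE9 ⇐ the named binders»; NOT summit progress
(cell pub-balaban: NE9 NOT PRINTED ∕ NOT PROVED; spine PROVED 0∕9; rung (B)+1 finite T⁴ — NOT infinite volume, NOT mass gap, NOT Clay; HONEST DEPENDENCY: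
continuum YM on T⁴ ⇐ BetaPertH ∧ nine spine estimates (0/9 proved); BetaPertH ⇐ (D1) ∧ (D4) ∧ CAP+tail; G-an2-4 gates asym, D1 and NE2/3/4).  Unit
`b2b-balaban-t4-ne9-formalise-leaf-04` (NE9 crux-team leaf prover, gen 71), INTENT I-ne9leaf04-g71-2 item (Q2′); NEW file importing `B9Eq3126H1BoundUniform`,
`B9Eq386ResolventLetters`, `B9Eq384LaplaceALipschitzUniform`; modifies nothing.  Net new unproved facts: 0.
-/

noncomputable section

open scoped InnerProductSpace ComplexConjugate

namespace Literature.MathematicalPhysics.QuantumFieldTheory.Balaban1983to89.B9Eq386LipschitzH1Uniform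

open B4Sect5Torus (TSite)
open B9SectCLatticeCarrier (Bond)
open B7Prop1Explicit (U1 Wcx boxVec)
open B9Eq311L2Pairing (WL2)
open B9Eq319QprimeTorus (fineP centre weight)
open B9Eq319Onto (centreFun)
open B11Eq103H1Complex (SiteL2K BondL2K covDerivL2K covDivL2K covLaplaceSiteK laplaceAK laplaceAK_apply laplaceALatticeK H1LatticeK G1LatticeK
  adjoint_injective_of_surjective)
open B9Eq310HessianOperator (adTransportW principalOpK hessOp hessOp_apply curvOp curvOp_one)
open B9Eq310DeltaPrime (plaqHolU)
open B9Eq326OperatorAssembly (RofU QprimeW)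
open B9Eq315QTorus (perCfg cornerSite QtorusW laplaceAofBackground)
open B9Eq315QTorusOnto (liftSite perSite_liftSite QtorusW_surjective)
open B5Eq172FlatCoercivity (hU1_one hreg_one)
open B9Eq373DerivativeRemainderL2 (norm_adjoint_apply_le)
open B9Eq384RemainderLetters (norm_centre_le norm_adTransportW_sub_le hRS_one)
open B9Eq383QSemiLocal (norm_QtorusW_sub_flat_le_local)
open B9Eq315QFlatNorm (norm_QtorusW_one_le)
open B9Eq315QFlatRightInverse (modulus_adjoint_QtorusW_one)
open B9Thm311SmallFieldClosedUniform (exists_coercive_laplaceA_of_small_field_uniform)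
open B9Eq3126GreenLetters (adjoint_injective_of_modulus)
open B9Eq3126H1Bound (norm_laplaceAofBackground_le)
open B9Eq386ResolventLetters (norm_G1K_sub_le norm_H1K_sub_le)
open B9Eq384LaplaceALipschitzUniform (exists_laplaceAofBackground_sub_flat_le_uniform)

variable {d : ℕ} (L : ℕ) [NeZero L] (hL : 1 ≤ L)
  {𝔸 : Type*} [NormedRing 𝔸] [NormedAlgebra ℂ 𝔸] [CompleteSpace 𝔸] [NormOneClass 𝔸]
  {W : Type*} [NormedAddCommGroup W] [InnerProductSpace ℂ W] [FiniteDimensional ℂ W] (φ : W ≃ₗ[ℂ] 𝔸) {c₀ c₁ : ℝ} [Fact (0 < c₀)] [Fact (0 < c₁)]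


section Assembled

variable [StarRing 𝔸] [NormedStarGroup 𝔸] [StarModule ℂ 𝔸]

/-! ## (3.86) and (3.126): `G₁(U)`, `H₁(U)` are Lipschitz in `U` at the flat point, `C₁, C₂, ε₇` BEFORE the volume -/

set_option maxHeartbeats 800000 in
/-- **THM 3.4 / (3.86) / (3.126), FIRST ORDER AT THE FLAT POINT, WITH `C₁, C₂, ε₇` INDEPENDENT OF THE VOLUME: `‖G₁(U) − G₁(1)‖ ≤ C₁·ε`,
`‖H₁(U) − H₁(1)‖ ≤ C₂·ε`** for the chain's `G₁(U) = B11Eq103H1Complex.G1LatticeK hpos` and `H₁(U) = H1LatticeK hpos hQ` (ANY witnesses at `U` and at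
`1`), on EVERY lattice `TSite d (L·m)`, at every background of E162's data with `‖U(b) − 1‖ ≤ ε ≤ ε₇` and `hRS`.  The owner's `exists_lipschitz_G1_H1_at_flat`
with the volume INSIDE: `δ_Δ = C_Δ·ε` by `exists_laplaceAofBackground_sub_flat_le_uniform` ((Q1′)), `γ₁` by `exists_coercive_laplaceA_of_small_field_uniform`
((E′)), `M_Q1 = M_φ′M_φ√(c₁/(c₀L^d))` by `norm_QtorusW_one_le`, `μ_Q1 = (√(c₀L^{d+2}/c₁))⁻¹` by `modulus_adjoint_QtorusW_one`, `C_Q` by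
`norm_QtorusW_sub_flat_le_local`; resolvent letters `B9Eq386ResolventLetters.norm_G1K_sub_le` / `norm_H1K_sub_le`.
[cite: Balaban1985BackgroundPropagators, Thm 3.4 p.400, (3.86) p.407, (3.126) p.420, Thm 3.11 p.416; Balaban1985Variational, (45) p.285] -/
theorem exists_lipschitz_G1_H1_at_flat_uniform {η : ℝ} (hη : η ≠ 0) {a : ℝ} (ha : 0 < a) {Mφ Mφ' : ℝ} (hMφ : 0 ≤ Mφ) (hMφ' : 0 ≤ Mφ')
    (hφ : ∀ w, ‖φ w‖ ≤ Mφ * ‖w‖) (hφ' : ∀ X, ‖φ.symm X‖ ≤ Mφ' * ‖X‖) (τ : 𝔸 →ₗ[ℂ] ℂ) {Cτ : ℝ} (hτ : ∀ X, ‖τ X‖ ≤ Cτ * ‖X‖) (hCτ : 0 ≤ Cτ) :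
    ∃ C₁ C₂ ε₇ : ℝ, 0 < C₁ ∧ 0 < C₂ ∧ 0 < ε₇ ∧ ∀ (m : Fin d → ℕ) [∀ i, NeZero (fineP L m i)] (U : Bond d (fineP L m) → 𝔸ˣ) {α : ℝ} (hα1 : α ≤ 1 / 64)
      (hU1 : ∀ (x : B7Prop1Explicit.Site d) (κ : Fin d), perCfg (fineP L m) U x κ ∈ U1 𝔸)
      (hreg : ∀ (y : TSite d m) (κ : Fin d) (r : Fin d → Fin L), ‖((Wcx L (perCfg (fineP L m) U) (cornerSite L y) κ (boxVec L r) : 𝔸ˣ) : 𝔸) - 1‖ ≤ α)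
      {ε : ℝ}, 0 ≤ ε → ε ≤ ε₇ → (∀ b, ‖(U b : 𝔸) - 1‖ ≤ ε) →
      (∀ (b : Bond d (fineP L m)) (v u : W), ⟪adTransportW φ U b v, u⟫_ℂ = ⟪v, adTransportW φ (fun b => (U b)⁻¹) b u⟫_ℂ) →
      ∀ (hpos : ∀ x : BondL2K ℂ d (fineP L m) c₀ W, x ≠ 0 →
          0 < RCLike.re ⟪x, laplaceAofBackground L m hL φ U hα1 hU1 hreg τ η (c₀ := c₀) (c₁ := c₁) a x⟫_ℂ)
        (hQ : Function.Surjective (QtorusW L m hL φ U hα1 hU1 hreg (c₀ := c₀) (c₁ := c₁)))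
        (hpos₁ : ∀ x : BondL2K ℂ d (fineP L m) c₀ W, x ≠ 0 →
          0 < RCLike.re ⟪x, laplaceAofBackground L m hL φ (fun _ => 1) (show (0 : ℝ) ≤ 1 / 64 by norm_num) (hU1_one L m) (hreg_one L m) τ η
            (c₀ := c₀) (c₁ := c₁) a x⟫_ℂ)
        (hQ₁ : Function.Surjective (QtorusW L m hL φ (fun _ => 1) (show (0 : ℝ) ≤ 1 / 64 by norm_num) (hU1_one L m) (hreg_one L m)
          (c₀ := c₀) (c₁ := c₁))),
      (∀ z : BondL2K ℂ d (fineP L m) c₀ W,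
        ‖G1LatticeK (Δ₁ := hessOp φ η U τ) (Q := QtorusW L m hL φ U hα1 hU1 hreg (c₀ := c₀) (c₁ := c₁)) hpos z -
          G1LatticeK (Δ₁ := hessOp φ η (fun _ => 1) τ)
            (Q := QtorusW L m hL φ (fun _ => 1) (show (0 : ℝ) ≤ 1 / 64 by norm_num) (hU1_one L m) (hreg_one L m) (c₀ := c₀) (c₁ := c₁)) hpos₁ z‖ ≤
        C₁ * ε * ‖z‖) ∧
      (∀ b : BondL2K ℂ d m c₁ W,
        ‖H1LatticeK (Δ₁ := hessOp φ η U τ) (Q := QtorusW L m hL φ U hα1 hU1 hreg (c₀ := c₀) (c₁ := c₁)) hpos hQ b -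
          H1LatticeK (Δ₁ := hessOp φ η (fun _ => 1) τ)
            (Q := QtorusW L m hL φ (fun _ => 1) (show (0 : ℝ) ≤ 1 / 64 by norm_num) (hU1_one L m) (hreg_one L m) (c₀ := c₀) (c₁ := c₁)) hpos₁ hQ₁ b‖ ≤
        C₂ * ε * ‖b‖) := by
  have hc₀ : 0 < c₀ := Fact.out
  have hc : conj ((η : ℂ))⁻¹ = ((η : ℂ))⁻¹ := by rw [map_inv₀, Complex.conj_ofReal]
  -- the uniform coercivity of `Δ_a(U)` (also at `U = 1`)
  obtain ⟨γ₁, ε₃, hγ₁, hε₃, Hc⟩ := exists_coercive_laplaceA_of_small_field_uniform L hL φ (c₀ := c₀) (c₁ := c₁) hη ha hMφ hMφ' hφ hφ' τ hτ hCτ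
  -- (3.84): `δ_Δ = C_Δ·ε`
  obtain ⟨CΔ, ε₆, hCΔ, hε₆, HΔ⟩ := exists_laplaceAofBackground_sub_flat_le_uniform L hL φ (c₀ := c₀) (c₁ := c₁) hη a hMφ hMφ' hφ hφ' τ hτ hCτ
  -- the flat averaging, VOLUME-FREE: `MQ1 = M_φ′M_φ√(c₁/(c₀L^d))` (leaf-03), `μQ1 = (√(c₀L^{d+2}/c₁))⁻¹` (leaf-04, explicit)
  have hc₁ : 0 < c₁ := Fact.out
  have hL0 : (0 : ℝ) < L := by exact_mod_cast Nat.pos_of_ne_zero (NeZero.ne L)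
  obtain ⟨MQ1, hMQ1def⟩ : ∃ MQ1 : ℝ, MQ1 = Mφ' * Mφ * Real.sqrt (c₁ / (c₀ * (L : ℝ) ^ d)) := ⟨_, rfl⟩
  have hMQ1 : 0 ≤ MQ1 := by rw [hMQ1def]; positivity
  obtain ⟨μQ1, hμQ1def⟩ : ∃ μQ1 : ℝ, μQ1 = (Real.sqrt (c₀ * (L : ℝ) ^ (d + 2) / c₁))⁻¹ := ⟨_, rfl⟩
  have hμQ1 : 0 < μQ1 := by rw [hμQ1def]; exact inv_pos.2 (Real.sqrt_pos.2 (by positivity))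
  -- the constants
  obtain ⟨KR, hKRdef⟩ : ∃ KR : ℝ, KR = 2 * Mφ * Mφ' := ⟨_, rfl⟩
  have hKR : 0 ≤ KR := by rw [hKRdef]; positivity
  obtain ⟨CQ, hCQdef⟩ : ∃ CQ : ℝ, CQ = Mφ' * Mφ * Real.sqrt (2 * d * c₁ / c₀) * (102 * (d + 1) ^ 2 * L) := ⟨_, rfl⟩
  have hCQ : 0 ≤ CQ := by rw [hCQdef]; positivity
  obtain ⟨MT, hMTdef⟩ : ∃ MT : ℝ, MT = 64 * d * ‖((η : ℂ))⁻¹‖ ^ 2 + 16 * ‖((η : ℂ))⁻¹‖ ^ 2 * d +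
      32 * d * Cτ * Mφ ^ 2 * (|η| ^ d / c₀) * (‖((η : ℂ))⁻¹‖ ^ 2 * (4 * 1)) + (MQ1 + CQ) * (|a| * (MQ1 + CQ)) + 1 := ⟨_, rfl⟩
  have hMT0 : 0 < MT := by rw [hMTdef]; positivity
  obtain ⟨κ, hκdef⟩ : ∃ κ : ℝ, κ = γ₁ * (μQ1 / 2) ^ 2 / MT ^ 2 := ⟨_, rfl⟩
  have hκ : 0 < κ := by rw [hκdef]; positivity
  refine ⟨γ₁⁻¹ * CΔ * γ₁⁻¹,
    γ₁⁻¹ * CΔ * γ₁⁻¹ * ((MQ1 + CQ) * κ⁻¹) + γ₁⁻¹ * (CQ * κ⁻¹) +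
      γ₁⁻¹ * ((MQ1 + CQ) * (κ⁻¹ * (CQ * (γ₁⁻¹ * (MQ1 + CQ)) + (MQ1 + CQ) * (γ₁⁻¹ * CΔ * γ₁⁻¹ * (MQ1 + CQ)) + (MQ1 + CQ) * (γ₁⁻¹ * CQ)) * κ⁻¹)) + 1,
    min ε₃ (min (1 / (KR + 1)) (min 1 (min (μQ1 / (2 * CQ + 1)) ε₆))), by positivity, by positivity, by positivity, ?_⟩
  intro m _ U α hα1 hU1 hreg ε hε hε₇ hUε hRS hpos hQs hpos₁ hQs₁
  -- the per-lattice flat letters at the volume-free constants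
  have hQ1 : ∀ x : BondL2K ℂ d (fineP L m) c₀ W,
      ‖QtorusW L m hL φ (fun _ => 1) (show (0 : ℝ) ≤ 1 / 64 by norm_num) (hU1_one L m) (hreg_one L m) (c₀ := c₀) (c₁ := c₁) x‖ ≤ MQ1 * ‖x‖ :=
    fun x => by
      rw [hMQ1def]
      exact norm_QtorusW_one_le L m hL (show (0 : ℝ) ≤ 1 / 64 by norm_num) (hU1_one L m) (hreg_one L m) φ hMφ hφ hMφ' hφ' x
  have hQ1adj : ∀ y : BondL2K ℂ d m c₁ W, μQ1 * ‖y‖ ≤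
      ‖LinearMap.adjoint (QtorusW L m hL φ (fun _ => 1) (show (0 : ℝ) ≤ 1 / 64 by norm_num) (hU1_one L m) (hreg_one L m) (c₀ := c₀) (c₁ := c₁)) y‖ :=
    fun y => by
      rw [hμQ1def]
      exact modulus_adjoint_QtorusW_one L m hL (show (0 : ℝ) ≤ 1 / 64 by norm_num) (hU1_one L m) (hreg_one L m) φ (c₀ := c₀) (c₁ := c₁) y
  have hεε₃ : ε ≤ ε₃ := hε₇.trans (min_le_left _ _)
  have hε1' : ε ≤ 1 / (KR + 1) := hε₇.trans ((min_le_right _ _).trans (min_le_left _ _))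
  have hε1 : ε ≤ 1 := hε₇.trans ((min_le_right _ _).trans ((min_le_right _ _).trans (min_le_left _ _)))
  have hεμ : ε ≤ μQ1 / (2 * CQ + 1) := hε₇.trans ((min_le_right _ _).trans ((min_le_right _ _).trans ((min_le_right _ _).trans (min_le_left _ _))))
  have hεε₆ : ε ≤ ε₆ := hε₇.trans ((min_le_right _ _).trans ((min_le_right _ _).trans ((min_le_right _ _).trans (min_le_right _ _))))
  have hεR1 : 2 * Mφ * Mφ' * ε ≤ 1 := by
    rw [← hKRdef]
    refine (mul_le_mul_of_nonneg_left hε1' hKR).trans ?_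
    rw [mul_one_div, div_le_one (by positivity)]; linarith
  have hεR1₀ : 2 * Mφ * Mφ' * (0 : ℝ) ≤ 1 := by norm_num
  have hδQ : CQ * ε ≤ μQ1 / 2 := by
    have h1 : CQ * ε ≤ CQ * (μQ1 / (2 * CQ + 1)) := mul_le_mul_of_nonneg_left hεμ hCQ
    have h2 : CQ * (μQ1 / (2 * CQ + 1)) ≤ μQ1 / 2 := by
      rw [mul_div_assoc', div_le_div_iff₀ (by positivity) (by norm_num)]; nlinarith
    exact h1.trans h2
  -- flat data: `‖1 − 1‖ ≤ 0`, `hRS` at `1`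
  have hU0 : ∀ b : Bond d (fineP L m), ‖(((fun _ => (1 : 𝔸ˣ)) b : 𝔸ˣ) : 𝔸) - 1‖ ≤ (0 : ℝ) := fun b => by simp
  have hRS₁ := hRS_one L m φ (𝔸 := 𝔸)
  -- `Q(U)`, `Q(1)`: operator bounds, difference, moduli of the adjoints
  have hQdiff : ∀ x : BondL2K ℂ d (fineP L m) c₀ W, ‖QtorusW L m hL φ U hα1 hU1 hreg (c₁ := c₁) x -
      QtorusW L m hL φ (fun _ => 1) (show (0 : ℝ) ≤ 1 / 64 by norm_num) (hU1_one L m) (hreg_one L m) (c₁ := c₁) x‖ ≤ CQ * ε * ‖x‖ := fun x => by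
    refine (norm_QtorusW_sub_flat_le_local L m hL U hα1 hU1 hreg (show (0 : ℝ) ≤ 1 / 64 by norm_num) (hU1_one L m) (hreg_one L m) hε hUε φ
      hMφ hφ hMφ' hφ' x).trans (le_of_eq ?_)
    rw [hCQdef]; ring
  have hQdiff' : ∀ x : BondL2K ℂ d (fineP L m) c₀ W,
      ‖QtorusW L m hL φ (fun _ => 1) (show (0 : ℝ) ≤ 1 / 64 by norm_num) (hU1_one L m) (hreg_one L m) (c₁ := c₁) x -
        QtorusW L m hL φ U hα1 hU1 hreg (c₁ := c₁) x‖ ≤ CQ * ε * ‖x‖ := fun x => by rw [norm_sub_rev]; exact hQdiff x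
  have hQU : ∀ x : BondL2K ℂ d (fineP L m) c₀ W, ‖QtorusW L m hL φ U hα1 hU1 hreg (c₀ := c₀) (c₁ := c₁) x‖ ≤ (MQ1 + CQ) * ‖x‖ := fun x => by
    have h1 := hQ1 x
    have h2 := hQdiff x
    have h3 := norm_le_insert' (QtorusW L m hL φ U hα1 hU1 hreg (c₀ := c₀) (c₁ := c₁) x)
      (QtorusW L m hL φ (fun _ => 1) (show (0 : ℝ) ≤ 1 / 64 by norm_num) (hU1_one L m) (hreg_one L m) (c₀ := c₀) (c₁ := c₁) x)
    have h4 : CQ * ε * ‖x‖ ≤ CQ * ‖x‖ := mul_le_mul_of_nonneg_right (mul_le_of_le_one_right hCQ hε1) (norm_nonneg x)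
    linarith
  have hQ1' : ∀ x : BondL2K ℂ d (fineP L m) c₀ W,
      ‖QtorusW L m hL φ (fun _ => 1) (show (0 : ℝ) ≤ 1 / 64 by norm_num) (hU1_one L m) (hreg_one L m) (c₀ := c₀) (c₁ := c₁) x‖ ≤ (MQ1 + CQ) * ‖x‖ :=
    fun x => (hQ1 x).trans (mul_le_mul_of_nonneg_right (le_add_of_nonneg_right hCQ) (norm_nonneg x))
  have hQUadj : ∀ y : BondL2K ℂ d m c₁ W, μQ1 / 2 * ‖y‖ ≤ ‖LinearMap.adjoint (QtorusW L m hL φ U hα1 hU1 hreg (c₀ := c₀) (c₁ := c₁)) y‖ := fun y => by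
    have h1 := hQ1adj y
    have h2 : ‖LinearMap.adjoint (QtorusW L m hL φ U hα1 hU1 hreg (c₀ := c₀) (c₁ := c₁) -
        QtorusW L m hL φ (fun _ => 1) (show (0 : ℝ) ≤ 1 / 64 by norm_num) (hU1_one L m) (hreg_one L m) (c₀ := c₀) (c₁ := c₁)) y‖ ≤ CQ * ε * ‖y‖ :=
      norm_adjoint_apply_le _ (by positivity) (fun x => by rw [LinearMap.sub_apply]; exact hQdiff x) y
    rw [map_sub, LinearMap.sub_apply] at h2
    have h3 := norm_le_insert (LinearMap.adjoint (QtorusW L m hL φ U hα1 hU1 hreg (c₀ := c₀) (c₁ := c₁)) y)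
      (LinearMap.adjoint (QtorusW L m hL φ (fun _ => 1) (show (0 : ℝ) ≤ 1 / 64 by norm_num) (hU1_one L m) (hreg_one L m) (c₀ := c₀) (c₁ := c₁)) y)
    have h4 : CQ * ε * ‖y‖ ≤ μQ1 / 2 * ‖y‖ := mul_le_mul_of_nonneg_right hδQ (norm_nonneg _)
    linarith
  have hQ1adj' : ∀ y : BondL2K ℂ d m c₁ W, μQ1 / 2 * ‖y‖ ≤
      ‖LinearMap.adjoint (QtorusW L m hL φ (fun _ => 1) (show (0 : ℝ) ≤ 1 / 64 by norm_num) (hU1_one L m) (hreg_one L m) (c₀ := c₀) (c₁ := c₁)) y‖ :=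
    fun y => (hQ1adj y).trans' (by nlinarith [norm_nonneg y, hμQ1])
  -- the operator bound `MT` and the coercivity `γ₁` of `Δ_a`, at `U` and at `1`, in the `laplaceAK` form
  have hMTU := norm_laplaceAofBackground_le L m hL φ hMφ hMφ' hφ hφ' τ hτ hCτ (η := η) a U hα1 hU1 hreg hε hεR1 hUε hRS (by positivity) hQU
  have hMT1 := norm_laplaceAofBackground_le L m hL φ hMφ hMφ' hφ hφ' τ hτ hCτ (η := η) a (fun _ => 1) (show (0 : ℝ) ≤ 1 / 64 by norm_num)
    (hU1_one L m) (hreg_one L m) le_rfl hεR1₀ hU0 hRS₁ (by positivity) hQ1'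
  have hMT : ∀ x : BondL2K ℂ d (fineP L m) c₀ W,
      ‖laplaceAK (hessOp φ η U τ) (covDerivL2K ℂ c₀ ((η : ℂ))⁻¹ (adTransportW φ U)) (RofU L m φ η U)
        (covDivL2K ℂ c₀ ((η : ℂ))⁻¹ (adTransportW φ fun b => (U b)⁻¹)) (QtorusW L m hL φ U hα1 hU1 hreg (c₀ := c₀) (c₁ := c₁))
        (LinearMap.adjoint (QtorusW L m hL φ U hα1 hU1 hreg (c₀ := c₀) (c₁ := c₁))) (RCLike.ofReal a) x‖ ≤ MT * ‖x‖ := fun x => by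
    refine (hMTU x).trans (mul_le_mul_of_nonneg_right ?_ (norm_nonneg _))
    rw [hMTdef]
    have h1 : 32 * d * Cτ * Mφ ^ 2 * (|η| ^ d / c₀) * (‖((η : ℂ))⁻¹‖ ^ 2 * (4 * ε)) ≤
        32 * d * Cτ * Mφ ^ 2 * (|η| ^ d / c₀) * (‖((η : ℂ))⁻¹‖ ^ 2 * (4 * 1)) := by gcongr
    linarith
  have hMT' : ∀ x : BondL2K ℂ d (fineP L m) c₀ W,
      ‖laplaceAK (hessOp φ η (fun _ => 1) τ) (covDerivL2K ℂ c₀ ((η : ℂ))⁻¹ (adTransportW φ fun _ => 1)) (RofU L m φ η fun _ => 1)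
        (covDivL2K ℂ c₀ ((η : ℂ))⁻¹ (adTransportW φ fun b => ((fun _ => (1 : 𝔸ˣ)) b)⁻¹))
        (QtorusW L m hL φ (fun _ => 1) (show (0 : ℝ) ≤ 1 / 64 by norm_num) (hU1_one L m) (hreg_one L m) (c₀ := c₀) (c₁ := c₁))
        (LinearMap.adjoint (QtorusW L m hL φ (fun _ => 1) (show (0 : ℝ) ≤ 1 / 64 by norm_num) (hU1_one L m) (hreg_one L m) (c₀ := c₀) (c₁ := c₁)))
        (RCLike.ofReal a) x‖ ≤ MT * ‖x‖ := fun x => by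
    refine (hMT1 x).trans (mul_le_mul_of_nonneg_right ?_ (norm_nonneg _))
    rw [hMTdef]
    have h1 : 32 * d * Cτ * Mφ ^ 2 * (|η| ^ d / c₀) * (‖((η : ℂ))⁻¹‖ ^ 2 * (4 * (0 : ℝ))) ≤
        32 * d * Cτ * Mφ ^ 2 * (|η| ^ d / c₀) * (‖((η : ℂ))⁻¹‖ ^ 2 * (4 * 1)) := by gcongr; norm_num
    linarith
  have hcoer : ∀ x : BondL2K ℂ d (fineP L m) c₀ W, γ₁ * ‖x‖ ^ 2 ≤ RCLike.re ⟪x,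
      laplaceAK (hessOp φ η U τ) (covDerivL2K ℂ c₀ ((η : ℂ))⁻¹ (adTransportW φ U)) (RofU L m φ η U)
        (covDivL2K ℂ c₀ ((η : ℂ))⁻¹ (adTransportW φ fun b => (U b)⁻¹)) (QtorusW L m hL φ U hα1 hU1 hreg (c₀ := c₀) (c₁ := c₁))
        (LinearMap.adjoint (QtorusW L m hL φ U hα1 hU1 hreg (c₀ := c₀) (c₁ := c₁))) (RCLike.ofReal a) x⟫_ℂ :=
    fun x => Hc m U hα1 hU1 hreg hε hεε₃ hUε hRS x
  have hcoer' : ∀ x : BondL2K ℂ d (fineP L m) c₀ W, γ₁ * ‖x‖ ^ 2 ≤ RCLike.re ⟪x,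
      laplaceAK (hessOp φ η (fun _ => 1) τ) (covDerivL2K ℂ c₀ ((η : ℂ))⁻¹ (adTransportW φ fun _ => 1)) (RofU L m φ η fun _ => 1)
        (covDivL2K ℂ c₀ ((η : ℂ))⁻¹ (adTransportW φ fun b => ((fun _ => (1 : 𝔸ˣ)) b)⁻¹))
        (QtorusW L m hL φ (fun _ => 1) (show (0 : ℝ) ≤ 1 / 64 by norm_num) (hU1_one L m) (hreg_one L m) (c₀ := c₀) (c₁ := c₁))
        (LinearMap.adjoint (QtorusW L m hL φ (fun _ => 1) (show (0 : ℝ) ≤ 1 / 64 by norm_num) (hU1_one L m) (hreg_one L m) (c₀ := c₀) (c₁ := c₁)))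
        (RCLike.ofReal a) x⟫_ℂ :=
    fun x => Hc m (fun _ => 1) (show (0 : ℝ) ≤ 1 / 64 by norm_num) (hU1_one L m) (hreg_one L m) le_rfl hε₃.le hU0 hRS₁ x
  have hpos' : ∀ x : BondL2K ℂ d (fineP L m) c₀ W, x ≠ 0 → 0 < RCLike.re ⟪x,
      laplaceAK (hessOp φ η U τ) (covDerivL2K ℂ c₀ ((η : ℂ))⁻¹ (adTransportW φ U)) (RofU L m φ η U)
        (covDivL2K ℂ c₀ ((η : ℂ))⁻¹ (adTransportW φ fun b => (U b)⁻¹)) (QtorusW L m hL φ U hα1 hU1 hreg (c₀ := c₀) (c₁ := c₁))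
        (LinearMap.adjoint (QtorusW L m hL φ U hα1 hU1 hreg (c₀ := c₀) (c₁ := c₁))) (RCLike.ofReal a) x⟫_ℂ := hpos
  have hpos₁' : ∀ x : BondL2K ℂ d (fineP L m) c₀ W, x ≠ 0 → 0 < RCLike.re ⟪x,
      laplaceAK (hessOp φ η (fun _ => 1) τ) (covDerivL2K ℂ c₀ ((η : ℂ))⁻¹ (adTransportW φ fun _ => 1)) (RofU L m φ η fun _ => 1)
        (covDivL2K ℂ c₀ ((η : ℂ))⁻¹ (adTransportW φ fun b => ((fun _ => (1 : 𝔸ˣ)) b)⁻¹))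
        (QtorusW L m hL φ (fun _ => 1) (show (0 : ℝ) ≤ 1 / 64 by norm_num) (hU1_one L m) (hreg_one L m) (c₀ := c₀) (c₁ := c₁))
        (LinearMap.adjoint (QtorusW L m hL φ (fun _ => 1) (show (0 : ℝ) ≤ 1 / 64 by norm_num) (hU1_one L m) (hreg_one L m) (c₀ := c₀) (c₁ := c₁)))
        (RCLike.ofReal a) x⟫_ℂ := hpos₁
  -- `δ_Δ`: the data difference in the `laplaceAK` form (flat minus `U`)
  have hδT : ∀ x : BondL2K ℂ d (fineP L m) c₀ W,
      ‖laplaceAK (hessOp φ η (fun _ => 1) τ) (covDerivL2K ℂ c₀ ((η : ℂ))⁻¹ (adTransportW φ fun _ => 1)) (RofU L m φ η fun _ => 1)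
          (covDivL2K ℂ c₀ ((η : ℂ))⁻¹ (adTransportW φ fun b => ((fun _ => (1 : 𝔸ˣ)) b)⁻¹))
          (QtorusW L m hL φ (fun _ => 1) (show (0 : ℝ) ≤ 1 / 64 by norm_num) (hU1_one L m) (hreg_one L m) (c₀ := c₀) (c₁ := c₁))
          (LinearMap.adjoint (QtorusW L m hL φ (fun _ => 1) (show (0 : ℝ) ≤ 1 / 64 by norm_num) (hU1_one L m) (hreg_one L m) (c₀ := c₀) (c₁ := c₁)))
          (RCLike.ofReal a) x -
        laplaceAK (hessOp φ η U τ) (covDerivL2K ℂ c₀ ((η : ℂ))⁻¹ (adTransportW φ U)) (RofU L m φ η U)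
          (covDivL2K ℂ c₀ ((η : ℂ))⁻¹ (adTransportW φ fun b => (U b)⁻¹)) (QtorusW L m hL φ U hα1 hU1 hreg (c₀ := c₀) (c₁ := c₁))
          (LinearMap.adjoint (QtorusW L m hL φ U hα1 hU1 hreg (c₀ := c₀) (c₁ := c₁))) (RCLike.ofReal a) x‖ ≤ CΔ * ε * ‖x‖ := fun x => by
    rw [norm_sub_rev]; exact HΔ m U hα1 hU1 hreg hε hεε₆ hUε hRS x
  have hμ2 : 0 < μQ1 / 2 := by positivity
  refine ⟨fun z => ?_, fun b => ?_⟩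
  · have h := norm_G1K_sub_le (𝕜 := ℂ) (E := BondL2K ℂ d (fineP L m) c₀ W) (F := BondL2K ℂ d m c₁ W) (S := SiteL2K ℂ d (fineP L m) c₀ W)
      (Δ₁ := hessOp φ η U τ (c₀ := c₀)) (Δ₂ := hessOp φ η (fun _ => 1) τ (c₀ := c₀))
      (D₁ := covDerivL2K ℂ c₀ ((η : ℂ))⁻¹ (adTransportW φ U)) (D₂ := covDerivL2K ℂ c₀ ((η : ℂ))⁻¹ (adTransportW φ fun _ => 1))
      (R₁ := RofU L m φ η U (c₀ := c₀)) (R₂ := RofU L m φ η (fun _ => 1) (c₀ := c₀))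
      (Ds₁ := covDivL2K ℂ c₀ ((η : ℂ))⁻¹ (adTransportW φ fun b => (U b)⁻¹))
      (Ds₂ := covDivL2K ℂ c₀ ((η : ℂ))⁻¹ (adTransportW φ fun b => ((fun _ => (1 : 𝔸ˣ)) b)⁻¹))
      (Q₁ := QtorusW L m hL φ U hα1 hU1 hreg (c₀ := c₀) (c₁ := c₁))
      (Q₂ := QtorusW L m hL φ (fun _ => 1) (show (0 : ℝ) ≤ 1 / 64 by norm_num) (hU1_one L m) (hreg_one L m) (c₀ := c₀) (c₁ := c₁))
      (a := RCLike.ofReal a) (γ := γ₁) (δT := CΔ * ε) hγ₁ hcoer hcoer' hpos' hpos₁' (by positivity) hδT z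
    have h' : ‖G1LatticeK (Δ₁ := hessOp φ η U τ) (Q := QtorusW L m hL φ U hα1 hU1 hreg (c₀ := c₀) (c₁ := c₁)) hpos z -
        G1LatticeK (Δ₁ := hessOp φ η (fun _ => 1) τ)
          (Q := QtorusW L m hL φ (fun _ => 1) (show (0 : ℝ) ≤ 1 / 64 by norm_num) (hU1_one L m) (hreg_one L m) (c₀ := c₀) (c₁ := c₁)) hpos₁ z‖ ≤
        γ₁⁻¹ * (CΔ * ε) * γ₁⁻¹ * ‖z‖ := h
    exact h'.trans (le_of_eq (by ring))
  · have h := norm_H1K_sub_le (𝕜 := ℂ) (E := BondL2K ℂ d (fineP L m) c₀ W) (F := BondL2K ℂ d m c₁ W) (S := SiteL2K ℂ d (fineP L m) c₀ W)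
      (Δ₁ := hessOp φ η U τ (c₀ := c₀)) (Δ₂ := hessOp φ η (fun _ => 1) τ (c₀ := c₀))
      (D₁ := covDerivL2K ℂ c₀ ((η : ℂ))⁻¹ (adTransportW φ U)) (D₂ := covDerivL2K ℂ c₀ ((η : ℂ))⁻¹ (adTransportW φ fun _ => 1))
      (R₁ := RofU L m φ η U (c₀ := c₀)) (R₂ := RofU L m φ η (fun _ => 1) (c₀ := c₀))
      (Ds₁ := covDivL2K ℂ c₀ ((η : ℂ))⁻¹ (adTransportW φ fun b => (U b)⁻¹))
      (Ds₂ := covDivL2K ℂ c₀ ((η : ℂ))⁻¹ (adTransportW φ fun b => ((fun _ => (1 : 𝔸ˣ)) b)⁻¹))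
      (Q₁ := QtorusW L m hL φ U hα1 hU1 hreg (c₀ := c₀) (c₁ := c₁))
      (Q₂ := QtorusW L m hL φ (fun _ => 1) (show (0 : ℝ) ≤ 1 / 64 by norm_num) (hU1_one L m) (hreg_one L m) (c₀ := c₀) (c₁ := c₁))
      (a := RCLike.ofReal a) (γ := γ₁) (MT := MT) (δT := CΔ * ε) hγ₁ hcoer hcoer' hMT hMT' hpos' hpos₁' (by positivity) hδT
      (MQ := MQ1 + CQ) (μQ := μQ1 / 2) (δQ := CQ * ε) (by positivity) hμ2 (by positivity) hQU hQ1' hQUadj hQ1adj' hQdiff'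
      (fun x' y' => (LinearMap.adjoint_inner_right _ x' y').symm) (adjoint_injective_of_modulus hμ2 hQUadj)
      (fun x' y' => (LinearMap.adjoint_inner_right _ x' y').symm) (adjoint_injective_of_modulus hμ2 hQ1adj') hMT0 b
    have h' : ‖H1LatticeK (Δ₁ := hessOp φ η U τ) (Q := QtorusW L m hL φ U hα1 hU1 hreg (c₀ := c₀) (c₁ := c₁)) hpos hQs b -
        H1LatticeK (Δ₁ := hessOp φ η (fun _ => 1) τ)
          (Q := QtorusW L m hL φ (fun _ => 1) (show (0 : ℝ) ≤ 1 / 64 by norm_num) (hU1_one L m) (hreg_one L m) (c₀ := c₀) (c₁ := c₁)) hpos₁ hQs₁ b‖ ≤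
        (γ₁⁻¹ * (CΔ * ε) * γ₁⁻¹ * ((MQ1 + CQ) * (γ₁ * (μQ1 / 2) ^ 2 / MT ^ 2)⁻¹) + γ₁⁻¹ * (CQ * ε * (γ₁ * (μQ1 / 2) ^ 2 / MT ^ 2)⁻¹) +
          γ₁⁻¹ * ((MQ1 + CQ) * ((γ₁ * (μQ1 / 2) ^ 2 / MT ^ 2)⁻¹ * (CQ * ε * (γ₁⁻¹ * (MQ1 + CQ)) +
            (MQ1 + CQ) * (γ₁⁻¹ * (CΔ * ε) * γ₁⁻¹ * (MQ1 + CQ)) + (MQ1 + CQ) * (γ₁⁻¹ * (CQ * ε))) * (γ₁ * (μQ1 / 2) ^ 2 / MT ^ 2)⁻¹))) * ‖b‖ := h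
    rw [← hκdef] at h'
    refine h'.trans ?_
    have hslack : 0 ≤ ε * ‖b‖ := mul_nonneg hε (norm_nonneg b)
    have hring : (γ₁⁻¹ * (CΔ * ε) * γ₁⁻¹ * ((MQ1 + CQ) * κ⁻¹) + γ₁⁻¹ * (CQ * ε * κ⁻¹) +
          γ₁⁻¹ * ((MQ1 + CQ) * (κ⁻¹ * (CQ * ε * (γ₁⁻¹ * (MQ1 + CQ)) +
            (MQ1 + CQ) * (γ₁⁻¹ * (CΔ * ε) * γ₁⁻¹ * (MQ1 + CQ)) + (MQ1 + CQ) * (γ₁⁻¹ * (CQ * ε))) * κ⁻¹))) * ‖b‖ + ε * ‖b‖ =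
        (γ₁⁻¹ * CΔ * γ₁⁻¹ * ((MQ1 + CQ) * κ⁻¹) + γ₁⁻¹ * (CQ * κ⁻¹) +
          γ₁⁻¹ * ((MQ1 + CQ) * (κ⁻¹ * (CQ * (γ₁⁻¹ * (MQ1 + CQ)) + (MQ1 + CQ) * (γ₁⁻¹ * CΔ * γ₁⁻¹ * (MQ1 + CQ)) + (MQ1 + CQ) * (γ₁⁻¹ * CQ)) * κ⁻¹)) + 1) *
          ε * ‖b‖ := by ring
    exact (le_add_of_nonneg_right hslack).trans hring.le

end Assembled

end Literature.MathematicalPhysics.QuantumFieldTheory.Balaban1983to89.B9Eq386LipschitzH1Uniform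

end
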